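import Summits.HodgeConjecture.HodgeConjecture.Theorems.TropicalWeilObstructionMumfordWeilShadowOfNumericalShadow
import Summits.HodgeConjecture.HodgeConjecture.Theorems.TropicalWeilObstructionTropicalHodgeBoundThetaLine
import Summits.HodgeConjecture.HodgeConjecture.Theorems.TropicalWeilObstructionGenericWeilPeriod
import Summits.HodgeConjecture.HodgeConjecture.Theorems.WeilTypeLadderOnPath
import Literature.AlgebraicGeometry.HodgeTheory.RationalClassesIndependent
import HarnessLib

/-!
# Crux `TropicalWeilVanishing` (K1, stmt-HodgeConjecture-18478) versus the Weil-type ladder: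
# the CLASSICAL EXCLUSION, kernel-checked

Route `HodgeConjecture/TropicalWeilObstruction` (a REFUTATION route; Kontsevich's tropical test, negative
branch). Cell `pub-hodge-tropical` — a negation SINK: scoped exploration, no claim on the Hodge conjecture
in either direction is made here. Lean companion of `K1-SCOPE.md` §3/§4C (C1) and of the route's KILL
CRITERIA ("a classical proof that Weil classes on very general Weil eightfolds over `ℚ(i)` are algebraic …
refutes `TropicalWeilVanishing` through `MumfordWeilShadow` + `TropicalHodgeBound`"), with the precision the
cell's referee asked for (`REFEREE-K1K2.md`, F1): WHICH case of the Hodge conjecture kills K1 depends on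
which transfer statement is granted. K3 (`TropicalHodgeBound`, p322554, in the pair form
`tropicalHodgeBound_pair` of p329881) and S (`GenericWeilPeriod`, p300187) are THEOREMS of the tree.

* `not_tropicalWeilVanishing_of_numericalShadow_of_splitEightfolds` — **(T) ∧ R2₈ ⟹ ¬K1**: the transfer
  hypothesis `MumfordWeilNumericalShadow` (T, p330403: a HYPERBOLIC Weil eightfold over `ℚ(i)` whose
  rational algebraic classes are numerically shadowed by effective tropical `4`-cycles) and rung R2₈
  `WeilTypeLadder.SplitEightfolds` (Weil classes on abelian eightfolds of SPLIT Weil type are algebraic;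
  only the slice `d = 1` is used) refute K1: the rational Weil pair of T's fibre is of type `(4,4)`
  (hyperbolic ⟹ balanced), algebraic by R2₈, cup-non-degenerate (§1); T shadows it, Gram extraction (§2)
  gives two effective tropical `4`-cycles with `ℚ`-independent classes, and `tropicalHodgeBound_pair`
  forbids both to have `W = 0`.
* `exists_nonalgebraic_weilClass_of_tropicalWeilVanishing_of_numericalShadow` — **K1 ∧ (T) ⟹ the
  counterexample SHAPE**: a hyperbolic Weil eightfold over `ℚ(i)` with a rational `(4,4)`-class IN ITS WEIL
  PLANE that is not algebraic; so under K1 the route's conclusion is literally `¬ SplitEightfolds` at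
  `d = 1` (`not_splitEightfolds_of_…`), Markman's open case ("dim `≥ 8` nothing for any `K`",
  arXiv:2502.03415 §1.2; arXiv:2509.23403 §11 p. 17 "only for `dim(X) ≤ 3`", §12 p. 20).
* `not_tropicalWeilVanishing_of_mumfordWeilShadow_of_weilClassesImaginaryQuadratic` — **K2 ∧ R∞ ⟹ ¬K1**:
  through the crux `MumfordWeilShadow` AS TYPED (no hyperbolicity conjunct, referee F1) the classical input
  is the `n = 4`, `d = 1` slice of R∞ `WeilTypeLadder.WeilClassesImaginaryQuadratic` (ANY discriminant);
  and `…_of_hodgeAbelianDimGeEight` — **K2 ∧ HC(abelian, dim ≥ 8) ⟹ ¬K1**, the assembly contraposed and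
  localised to the registered residual `SevenfoldWeilCensus.HodgeAbelianDimGeEight` (stmt-18722).

HONEST STATUS. K1 is OPEN (grade: open problem); (T) is a NAMED OPEN transfer hypothesis (not in print as
stated); R2₈ / R∞ / HC(abelian, dim ≥ 8) are OPEN cases of the Hodge conjecture (`@[conjecture]` leaves of
`Theorems/WeilTypeLadder`, resp. a route item). Every theorem below is an implication between these;
nothing here decides K1, any rung, or the Hodge conjecture. No definition, no named fact, no sorry.

## References

* [Zharkov2020TropicalWeil] I. Zharkov, arXiv:2002.02347, pp. 2–4 (Kontsevich's scheme; "the converse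
  implication though may be false"). [Markman2025SecantWeil] arXiv:2502.03415, §1.2, Thm. 1.5.1;
  [Markman2025SurveySecant] arXiv:2509.23403, §11 (p. 17), §12 (p. 20). [vanGeemen1994HodgeAV] LNM 1594,
  4.9–4.11, 5.2–5.4, Thm. 6.12. [Weil1977HodgeRing] A. Weil, Abelian varieties and the Hodge ring (1977).
-/

set_option linter.dupNamespace false

noncomputable section
open CategoryTheory
open Literature.AlgebraicGeometry Literature.AlgebraicGeometry.Motives
open Literature.AlgebraicGeometry.HodgeTheory Literature.AlgebraicGeometry.Tropical
open Literature.AlgebraicTopology.SingularHomology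
open scoped BigOperators

namespace Summit.HodgeConjecture.HodgeConjecture.Theorems.TropicalWeilVanishing

open Summit.HodgeConjecture.HodgeConjecture.Theses.TropicalWeilObstruction
open Summit.HodgeConjecture.HodgeConjecture.Theorems.MumfordWeilShadow
open Summit.HodgeConjecture.HodgeConjecture.Theorems.TropicalHodgeBound
open Summit.HodgeConjecture.HodgeConjecture.WeilTypeLadder

/-! ## §1 Linear algebra of the Weil plane: an independent pair has non-degenerate cup form -/

section WeilPlane

variable {A : AbelianVariety ℂ}

/-- **An independent pair spans the Weil plane.** For `dim A = 2n`, `φ ≫ φ = -d` (`n, d ≥ 1`), two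
`ℂ`-linearly independent classes of `weilClassesOf A φ n d` span it (`dim W = 2`,
`finrank_weilClassesOf_eq_two`). [cite: vanGeemen1994HodgeAV, 4.9] -/
theorem weilClassesOf_le_span_of_linearIndependent_pair {n d : ℕ} (hn : 0 < n) (hA : A.dim = 2 * n)
    (hd : 0 < d) {φ : A ⟶ A} (hφ : φ ≫ φ = -(d • 𝟙 A)) {u : Fin 2 → complexBetti A.X (2 * n)}
    (huW : ∀ j, u j ∈ weilClassesOf A φ n d) (hli : LinearIndependent ℂ u) :
    weilClassesOf A φ n d ≤ Submodule.span ℂ (Set.range u) := by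
  haveI := finite_complexBetti_abelianVariety A (2 * n)
  have hΛ := Motives.AbelianVariety.hasExteriorCohomologyH1_complexPoints A
  have hb₁ : Module.finrank ℂ (complexBetti A.X 1) = 2 * (2 * n) := by
    rw [Motives.AbelianVariety.finrank_complexBetti_one, hA]
  have h2 := finrank_weilClassesOf_eq_two hΛ hb₁ hn hd hφ
  haveI : FiniteDimensional ℂ (weilClassesOf A φ n d) := Module.finite_of_finrank_eq_succ h2
  have hle : Submodule.span ℂ (Set.range u) ≤ weilClassesOf A φ n d := by
    rw [Submodule.span_le]
    rintro _ ⟨j, rfl⟩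
    exact huW j
  have hcard : Module.finrank ℂ (Submodule.span ℂ (Set.range u)) = 2 := by
    rw [finrank_span_eq_card hli, Fintype.card_fin]
  exact (Submodule.eq_of_le_of_finrank_le hle (by rw [h2, hcard])).ge

/-- **Non-degeneracy of the cup form on an independent Weil pair.** For `dim A = 2n`, `φ ≫ φ = -d`
(`n, d ≥ 1`) and a `ℂ`-independent pair `u₀, u₁` of the Weil plane: for every rational `l ≠ 0`,
`(l₀u₀ + l₁u₁) ⌣ u_{k'} ≠ 0` for some `k'` (the non-zero class `w = l₀u₀ + l₁u₁ ∈ W` pairs non-trivially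
with some `y ∈ W = span{u₀, u₁}`, `exists_cupProduct_ne_zero_of_mem_weilClassesOf`).
[cite: vanGeemen1994HodgeAV, 4.9–4.11 and proof of Thm. 6.12] -/
theorem weilPair_cupProduct_nondegenerate {n d : ℕ} (hn : 0 < n) (hA : A.dim = 2 * n) (hd : 0 < d)
    {φ : A ⟶ A} (hφ : φ ≫ φ = -(d • 𝟙 A)) {k : ℕ} (hk : 2 * n + 2 * n = k)
    {u : Fin 2 → complexBetti A.X (2 * n)} (huW : ∀ j, u j ∈ weilClassesOf A φ n d)
    (hli : LinearIndependent ℂ u) :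
    ∀ l : Fin 2 → ℚ, l ≠ 0 → ∃ k', cupProduct hk (∑ j, ((l j : ℚ) : ℂ) • u j) (u k') ≠ 0 := by
  intro l hl
  have hw0 : ∑ j, ((l j : ℚ) : ℂ) • u j ≠ 0 := by
    intro h0
    apply hl
    funext j
    have := Fintype.linearIndependent_iff.1 hli (fun j => ((l j : ℚ) : ℂ)) h0 j
    exact_mod_cast this
  have hwW : ∑ j, ((l j : ℚ) : ℂ) • u j ∈ weilClassesOf A φ n d :=
    Submodule.sum_mem _ fun j _ => Submodule.smul_mem _ _ (huW j)
  obtain ⟨y, hyW, hy⟩ := exists_cupProduct_ne_zero_of_mem_weilClassesOf hn hA hd hφ hk hwW hw0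
  obtain ⟨c, hc⟩ := (Submodule.mem_span_range_iff_exists_fun ℂ).mp
    (weilClassesOf_le_span_of_linearIndependent_pair hn hA hd hφ huW hli hyW)
  by_contra! hall
  apply hy
  rw [← hc, map_sum]
  exact Finset.sum_eq_zero fun j _ => by rw [map_smul, hall j, smul_zero]

end WeilPlane

/-! ## §2 The Gram argument: numerically shadowed non-degenerate families give independent effective classes -/

/-- **Gram extraction.** Let `δ` be an injective functional on `H¹⁶(A(ℂ); ℂ)` and `a₁, …, a_m ∈ H⁸` a
family whose rational span carries a NON-DEGENERATE cup form. If `δ(a_k ⌣ a_{k'}) = β(v_k, v_{k'})` for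
rational combinations `v_k = Σ_j r_{kj} · cyc Z_j` of classes of effective tropical `4`-cycles `Z_j` on
`ℝ⁸/Qℤ⁸` (`β` = `tropicalIntersectionPairing`), then `m` effective tropical `4`-cycles with `ℚ`-independent
classes exist: a rational relation `Σ g_k v_k = 0` gives `δ((Σ g_k a_k) ⌣ a_{k'}) = 0` for all `k'`, so
`g = 0`, and `exists_linearIndependent_comp_of_mem_span` extracts (the argument of
`mumfordWeilShadow_of_numericalShadow`, p330403, for ONE fibre). [cite: Zharkov2020TropicalWeil, pp. 2–4] -/
theorem exists_linearIndependent_cyc_of_gram {Q : Matrix (Fin (2 * 4)) (Fin (2 * 4)) ℝ}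
    {A : AbelianVariety ℂ} {δ : complexBetti A.X 16 →ₗ[ℂ] ℂ} (hδ : Function.Injective δ) {m : ℕ}
    {a : Fin m → complexBetti A.X (2 * 4)}
    (hnd : ∀ l : Fin m → ℚ, l ≠ 0 →
      ∃ k', cupProduct (show 2 * 4 + 2 * 4 = 16 by norm_num) (∑ k, ((l k : ℚ) : ℂ) • a k) (a k') ≠ 0)
    {N : ℕ} {Z : Fin N → TropicalTorusCycle (2 * 4) 4 Q} {r : Fin m → Fin N → ℚ}
    (hgram : ∀ k k', δ (cupProduct (show 2 * 4 + 2 * 4 = 16 by norm_num) (a k) (a k')) =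
      ((tropicalIntersectionPairing (∑ j, ((r k j : ℚ) : ℝ) • (Z j).cyc)
        (∑ j, ((r k' j : ℚ) : ℝ) • (Z j).cyc) : ℝ) : ℂ)) :
    ∃ c : Fin m → TropicalTorusCycle (2 * 4) 4 Q, LinearIndependent ℚ fun k => (c k).cyc := by
  set v : Fin m → (Fin 4 → Fin (2 * 4)) → (Fin 4 → Fin (2 * 4)) → ℝ :=
    fun k => ∑ j, ((r k j : ℚ) : ℝ) • (Z j).cyc with hv
  have hmem : ∀ k, v k ∈ Submodule.span ℚ (Set.range
      (TropicalTorusCycle.cyc : TropicalTorusCycle (2 * 4) 4 Q →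
        (Fin 4 → Fin (2 * 4)) → (Fin 4 → Fin (2 * 4)) → ℝ)) := by
    intro k
    refine Submodule.sum_mem _ fun j _ => ?_
    rw [Rat.cast_smul_eq_qsmul ℝ (r k j)]
    exact Submodule.smul_mem _ _ (Submodule.subset_span ⟨Z j, rfl⟩)
  have hli : LinearIndependent ℚ v := by
    rw [Fintype.linearIndependent_iff]
    intro g hg
    by_contra hne
    push Not at hne
    obtain ⟨k₀, hk₀⟩ := hne
    have hg0 : g ≠ 0 := fun h => hk₀ (by simp [h])
    obtain ⟨k', hk'⟩ := hnd g hg0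
    apply hk'
    have hzero : ∑ k, ((g k : ℚ) : ℝ) • v k = 0 := by
      have e : ∑ k, ((g k : ℚ) : ℝ) • v k = ∑ k, g k • v k :=
        Finset.sum_congr rfl fun k _ => Rat.cast_smul_eq_qsmul ℝ (g k) (v k)
      rw [e, hg]
    have hδ0 : δ (cupProduct (show 2 * 4 + 2 * 4 = 16 by norm_num)
        (∑ k, ((g k : ℚ) : ℂ) • a k) (a k')) = 0 := by
      rw [map_sum, LinearMap.sum_apply, map_sum]
      simp_rw [map_smul, LinearMap.smul_apply, map_smul, smul_eq_mul, hgram]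
      have hcast : ∑ k, ((g k : ℚ) : ℂ) *
          ((tropicalIntersectionPairing (v k) (v k') : ℝ) : ℂ) =
          ((∑ k, ((g k : ℚ) : ℝ) * tropicalIntersectionPairing (v k) (v k') : ℝ) : ℂ) := by
        push_cast
        rfl
      rw [hcast, ← tropicalIntersectionPairing_sum_smul_left, hzero,
        tropicalIntersectionPairing_zero_left, Complex.ofReal_zero]
    exact hδ (by rw [hδ0, map_zero])
  exact exists_linearIndependent_comp_of_mem_span TropicalTorusCycle.cyc hli hmem

/-! ## §3 The core: on ONE fibre, algebraic Weil classes force an effective tropical cycle with `W ≠ 0` -/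

/-- **Core of the classical exclusion.** Let `Q` be a very general tropical Weil period and `(A, φ, e, a, δ)`
data as delivered by `MumfordWeilNumericalShadow` over `Q` (`dim A = 8`, `φ ≫ φ = -𝟙`, `a ≠ 0` rational,
`(A, φ)` HYPERBOLIC for `h_K = e^*a + φ^*e^*a`, `δ` injective on `H¹⁶`, every finite family of rational
algebraic classes in `H⁸` numerically shadowed by effective tropical `4`-cycles on `ℝ⁸/Qℤ⁸`). IF every
rational `(4,4)`-class of the Weil plane `weilClassesOf A φ 4 1` is algebraic, THEN some effective tropical
`4`-cycle on `ℝ⁸/Qℤ⁸` has `W ≠ 0`: the rational Weil pair (`exists_isRationalClass_pair_span_weilClassesOf`)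
is of type `(4,4)` (`isOfHodgeType_of_mem_weilClassesOf_of_isHyperbolicWeilType`), algebraic by hypothesis,
cup-non-degenerate (§1); Gram extraction (§2) gives two effective cycles with independent classes;
`tropicalHodgeBound_pair` (K3 sharpened) forbids both to have `W = 0`.
[cite: Zharkov2020TropicalWeil, pp. 2–4] [cite: vanGeemen1994HodgeAV, 4.9–4.11, 5.4] -/
theorem exists_weilFunctional_ne_zero_of_weilClasses_algebraic
    {Q : Matrix (Fin (2 * 4)) (Fin (2 * 4)) ℝ} (hQ : Q.PosDef) (hQJ : Q * weilJ 4 = weilJ 4 * Q)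
    (hgen : IsWeilGeneric 4 Q) {A : AbelianVariety ℂ} {φ : A ⟶ A} (e : ProjectiveEmbedding A.X)
    {a : complexBetti (projectiveSpace e.n ℂ) 2} {δ : complexBetti A.X 16 →ₗ[ℂ] ℂ}
    (hdim : A.dim = 8) (hφ : φ ≫ φ = -(𝟙 A)) (ha : IsRationalClass a) (ha0 : a ≠ 0)
    (hhyp : IsHyperbolicWeilType A φ 4
      (complexBetti.map e.ι 2 a + complexBetti.map φ.hom.hom.hom 2 (complexBetti.map e.ι 2 a)))
    (hδ : Function.Injective δ)
    (hsh : ∀ (m : ℕ) (c : Fin m → complexBetti A.X (2 * 4)),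
      (∀ k, IsRationalClass (c k)) → (∀ k, c k ∈ algebraicClasses A.X 4) →
        ∃ (N : ℕ) (Z : Fin N → TropicalTorusCycle (2 * 4) 4 Q) (r : Fin m → Fin N → ℚ),
          ∀ k k', δ (cupProduct (show 2 * 4 + 2 * 4 = 16 by norm_num) (c k) (c k')) =
            ((tropicalIntersectionPairing (∑ j, ((r k j : ℚ) : ℝ) • (Z j).cyc)
              (∑ j, ((r k' j : ℚ) : ℝ) • (Z j).cyc) : ℝ) : ℂ))
    (halg : ∀ c : complexBetti A.X (2 * 4), IsRationalClass c →
      IsOfHodgeType (2 * 4) A.X (2 * 4) 4 4 c → c ∈ weilClassesOf A φ 4 1 → c ∈ algebraicClasses A.X 4) :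
    ∃ Z : TropicalTorusCycle (2 * 4) 4 Q, weilFunctional Z ≠ 0 := by
  have hA : A.dim = 2 * 4 := hdim
  have hφ' : φ ≫ φ = -((1 : ℕ) • 𝟙 A) := by rwa [one_smul]
  have hK1 : ((1 : ℕ) : ℂ) • complexBetti.map e.ι 2 a +
      complexBetti.map φ.hom.hom.hom 2 (complexBetti.map e.ι 2 a) =
      complexBetti.map e.ι 2 a + complexBetti.map φ.hom.hom.hom 2 (complexBetti.map e.ι 2 a) := by
    rw [Nat.cast_one, one_smul]
  have hhyp' : IsHyperbolicWeilType A φ 4 (((1 : ℕ) : ℂ) • complexBetti.map e.ι 2 a +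
      complexBetti.map φ.hom.hom.hom 2 (complexBetti.map e.ι 2 a)) := by
    rw [hK1]; exact hhyp
  -- the rational Weil pair
  obtain ⟨u₁, u₂, hu₁r, hu₂r, hu₁W, hu₂W, hli, -⟩ :=
    exists_isRationalClass_pair_span_weilClassesOf (n := 4) (by norm_num) hA Nat.one_pos hφ'
  set u : Fin 2 → complexBetti A.X (2 * 4) := ![u₁, u₂] with hu
  have hurat : ∀ j, IsRationalClass (u j) := by
    intro j; fin_cases j
    · exact hu₁r
    · exact hu₂r
  have huW : ∀ j, u j ∈ weilClassesOf A φ 4 1 := by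
    intro j; fin_cases j
    · exact hu₁W
    · exact hu₂W
  have huH : ∀ j, IsOfHodgeType (2 * 4) A.X (2 * 4) 4 4 (u j) := fun j =>
    isOfHodgeType_of_mem_weilClassesOf_of_isHyperbolicWeilType (n := 4) (by norm_num) Nat.one_pos hA
      hφ' e ha ha0 hhyp' (huW j)
  have hualg : ∀ j, u j ∈ algebraicClasses A.X 4 := fun j => halg (u j) (hurat j) (huH j) (huW j)
  have hnd : ∀ l : Fin 2 → ℚ, l ≠ 0 →
      ∃ k', cupProduct (show 2 * 4 + 2 * 4 = 16 by norm_num) (∑ k, ((l k : ℚ) : ℂ) • u k) (u k') ≠ 0 :=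
    weilPair_cupProduct_nondegenerate (n := 4) (by norm_num) hA Nat.one_pos hφ' _ huW hli
  -- shadow, Gram extraction, and the tropical Hodge bound for pairs
  obtain ⟨N, Z, r, hgram⟩ := hsh 2 u hurat hualg
  obtain ⟨c, hc⟩ := exists_linearIndependent_cyc_of_gram hδ hnd hgram
  by_contra! hall
  exact tropicalHodgeBound_pair Q hQ hQJ hgen c (fun j => hall (c j)) hc

/-! ## §4 The exclusions, by name -/

/-- **(T) ∧ R2₈ ⟹ ¬K1.** The transfer hypothesis `MumfordWeilNumericalShadow` together with rung R2₈
`WeilTypeLadder.SplitEightfolds` (Weil classes on abelian eightfolds of split Weil type are algebraic; only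
its slice `d = 1`, `K = ℚ(i)` is used) refutes the tropical bet `TropicalWeilVanishing`: a Markman-type
theorem for split eightfolds over `ℚ(i)` would, granted (T), kill the route `TropicalWeilObstruction` at
K1 (K1-SCOPE §4C (C1), kernel form). Uses K3 (p322554/p329881) and S (p300187) as theorems.
[cite: Zharkov2020TropicalWeil, pp. 2–4] [cite: Markman2025SecantWeil, §1.2] -/
theorem not_tropicalWeilVanishing_of_numericalShadow_of_splitEightfolds
    (hT : MumfordWeilNumericalShadow) (hR : SplitEightfolds) : ¬ TropicalWeilVanishing := by
  intro h1
  obtain ⟨Q, hQ, hQJ, hgen⟩ := tropicalWeilObstruction_genericWeilPeriod_proof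
  obtain ⟨A, φ, e, a, δ, hdim, hφ, ha, ha0, hhyp, hδ, hsh⟩ := hT Q hQ hQJ hgen
  have hφ' : φ ≫ φ = -((1 : ℕ) • 𝟙 A) := by rwa [one_smul]
  have hhyp' : IsHyperbolicWeilType A φ 4 (((1 : ℕ) : ℂ) • complexBetti.map e.ι 2 a +
      complexBetti.map φ.hom.hom.hom 2 (complexBetti.map e.ι 2 a)) := by
    rw [Nat.cast_one, one_smul]; exact hhyp
  obtain ⟨Z, hZ⟩ := exists_weilFunctional_ne_zero_of_weilClasses_algebraic hQ hQJ hgen e hdim hφ ha ha0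
    hhyp hδ hsh fun c hc h44 hW =>
      hR 1 Nat.one_pos A φ hdim (Motives.isSmoothProjective_of_dim_eq' hdim) hφ' e a ha ha0 hhyp' c hc h44 hW
  exact hZ (h1 Q hQ hQJ hgen Z)

/-- **K1 ∧ (T) ⟹ THE COUNTEREXAMPLE SHAPE.** Under the tropical bet and the transfer principle there is a
HYPERBOLIC Weil eightfold `(A, φ)` over `ℚ(i)` (`dim A = 8`, `φ ≫ φ = -𝟙`, hyperbolic for a
`K`-symmetrised hyperplane class `e^*a + φ^*e^*a`, `a ≠ 0` rational) — namely (T)'s fibre over any very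
general tropical Weil period — and a RATIONAL class of Hodge type `(4,4)` in its WEIL PLANE
`weilClassesOf A φ 4 1` that is NOT algebraic. This is what "K2 under K1 is literally ¬HC for the Weil
classes of some Weil eightfold over `ℚ(i)`" (K2-SIZE §2) means for (T)'s witness; it is an implication
between open statements and asserts the existence of nothing. [cite: Zharkov2020TropicalWeil, pp. 2–4] -/
theorem exists_nonalgebraic_weilClass_of_tropicalWeilVanishing_of_numericalShadow
    (h1 : TropicalWeilVanishing) (hT : MumfordWeilNumericalShadow) :
    ∃ (A : AbelianVariety ℂ) (φ : A ⟶ A) (e : ProjectiveEmbedding A.X)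
      (a : complexBetti (projectiveSpace e.n ℂ) 2) (c : complexBetti A.X (2 * 4)),
      A.dim = 8 ∧ φ ≫ φ = -(𝟙 A) ∧ IsRationalClass a ∧ a ≠ 0 ∧
      IsHyperbolicWeilType A φ 4
        (complexBetti.map e.ι 2 a + complexBetti.map φ.hom.hom.hom 2 (complexBetti.map e.ι 2 a)) ∧
      IsRationalClass c ∧ IsOfHodgeType (2 * 4) A.X (2 * 4) 4 4 c ∧ c ∈ weilClassesOf A φ 4 1 ∧
      c ∉ algebraicClasses A.X 4 := by
  obtain ⟨Q, hQ, hQJ, hgen⟩ := tropicalWeilObstruction_genericWeilPeriod_proof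
  obtain ⟨A, φ, e, a, δ, hdim, hφ, ha, ha0, hhyp, hδ, hsh⟩ := hT Q hQ hQJ hgen
  by_cases halg : ∀ c : complexBetti A.X (2 * 4), IsRationalClass c →
      IsOfHodgeType (2 * 4) A.X (2 * 4) 4 4 c → c ∈ weilClassesOf A φ 4 1 → c ∈ algebraicClasses A.X 4
  · obtain ⟨Z, hZ⟩ := exists_weilFunctional_ne_zero_of_weilClasses_algebraic hQ hQJ hgen e hdim hφ ha
      ha0 hhyp hδ hsh halg
    exact absurd (h1 Q hQ hQJ hgen Z) hZ
  · push Not at halg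
    obtain ⟨c, hc, h44, hW, hnot⟩ := halg
    exact ⟨A, φ, e, a, c, hdim, hφ, ha, ha0, hhyp, hc, h44, hW, hnot⟩

/-- **K1 ∧ (T) ⟹ ¬R2₈** — the honest reading of the route's conclusion: the tropical bet plus the transfer
principle refute the split-eightfold rung of the Weil-type ladder, by the explicit non-algebraic Weil class
of `exists_nonalgebraic_weilClass_of_tropicalWeilVanishing_of_numericalShadow` (and only through that rung
the Hodge conjecture, `WeilTypeLadder.splitEightfolds_of_hodgeConjecture`). [cite: Zharkov2020TropicalWeil, pp. 2–4] -/
theorem not_splitEightfolds_of_tropicalWeilVanishing_of_numericalShadow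
    (h1 : TropicalWeilVanishing) (hT : MumfordWeilNumericalShadow) : ¬ SplitEightfolds := by
  intro hR
  obtain ⟨A, φ, e, a, c, hdim, hφ, ha, ha0, hhyp, hc, h44, hW, hnot⟩ :=
    exists_nonalgebraic_weilClass_of_tropicalWeilVanishing_of_numericalShadow h1 hT
  have hφ' : φ ≫ φ = -((1 : ℕ) • 𝟙 A) := by rwa [one_smul]
  have hhyp' : IsHyperbolicWeilType A φ 4 (((1 : ℕ) : ℂ) • complexBetti.map e.ι 2 a +
      complexBetti.map φ.hom.hom.hom 2 (complexBetti.map e.ι 2 a)) := by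
    rw [Nat.cast_one, one_smul]; exact hhyp
  exact hnot (hR 1 Nat.one_pos A φ hdim (Motives.isSmoothProjective_of_dim_eq' hdim) hφ' e a ha ha0
    hhyp' c hc h44 hW)

/-- Sanity (the route's assembly re-derived through (T) and the ladder): K1 ∧ (T) ⟹ ¬HC, because
`HodgeConjecture → SplitEightfolds`. Nothing new — it shows that the exclusion factors the assembly.
[cite: Zharkov2020TropicalWeil, pp. 2–4] -/
theorem not_hodgeConjecture_of_tropicalWeilVanishing_of_numericalShadow
    (h1 : TropicalWeilVanishing) (hT : MumfordWeilNumericalShadow) : ¬ _root_.HodgeConjecture :=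
  fun hHC => not_splitEightfolds_of_tropicalWeilVanishing_of_numericalShadow h1 hT
    (splitEightfolds_of_hodgeConjecture hHC)

/-- **K2 ∧ R∞ ⟹ ¬K1** — through the crux `MumfordWeilShadow` AS TYPED. Its witness `(A, φ)` carries no
hyperbolicity conjunct (referee F1), so the classical input that kills K1 through K2 is the
any-discriminant statement: the slice `n = 4`, `d = 1` of rung R∞ `WeilTypeLadder.WeilClassesImaginaryQuadratic`
(Weil's question for `ℚ(i)`-Weil eightfolds). The Weil pair `u₁, u₂` of K2's triple is `ℂ`-independent
(`linearIndependent_of_isRationalClass`: a rational relation would kill every cup product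
`(l₁u₁ + l₂u₂) ⌣ u_{k'}`, against K2's non-degeneracy), hence cup-non-degenerate (§1); K2's shadow clause
(`m = 2`) gives two effective tropical `4`-cycles with independent classes, and `tropicalHodgeBound_pair`
forbids both to have `W = 0`. [cite: Zharkov2020TropicalWeil, pp. 2–4] [cite: Weil1977HodgeRing] -/
theorem not_tropicalWeilVanishing_of_mumfordWeilShadow_of_weilClassesImaginaryQuadratic
    (h2 : MumfordWeilShadow) (hR : WeilClassesImaginaryQuadratic) : ¬ TropicalWeilVanishing := by
  intro h1
  obtain ⟨Q, hQ, hQJ, hgen⟩ := tropicalWeilObstruction_genericWeilPeriod_proof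
  obtain ⟨A, φ, u, hdim, hφ, hu, hu1, hu2, hnd, hshadow⟩ := h2 Q hQ hQJ hgen
  have hA : A.dim = 2 * 4 := hdim
  have hX : IsSmoothProjective (2 * 4) A.X := Motives.isSmoothProjective_of_dim_eq' hdim
  have hφ' : φ ≫ φ = -((1 : ℕ) • 𝟙 A) := by rwa [one_smul]
  -- the Weil pair of the triple
  set v : Fin 2 → complexBetti A.X (2 * 4) := ![u 1, u 2] with hv
  have hv_eq : ∀ l : Fin 2 → ℚ,
      ∑ j, ((l j : ℚ) : ℂ) • v j = ∑ k, ((![0, l 0, l 1] k : ℚ) : ℂ) • u k := by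
    intro l
    simp [hv, Fin.sum_univ_two, Fin.sum_univ_three]
  have hvrat : ∀ j, IsRationalClass (v j) := by
    intro j; fin_cases j
    · exact (hu 1).1
    · exact (hu 2).1
  have hvH : ∀ j, IsOfHodgeType (2 * 4) A.X (2 * 4) 4 4 (v j) := by
    intro j; fin_cases j
    · exact (hu 1).2
    · exact (hu 2).2
  have hvW : ∀ j, v j ∈ weilClassesOf A φ 4 1 := by
    intro j; fin_cases j
    · exact hu1
    · exact hu2
  have hvalg : ∀ j, v j ∈ algebraicClasses A.X 4 := fun j =>
    hR 4 (by norm_num) 1 Nat.one_pos A φ hA hX hφ' (v j) (hvrat j) (hvH j) (hvW j)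
  -- `ℂ`-independence of the pair from the triple's non-degeneracy
  have hli : LinearIndependent ℂ v := by
    refine linearIndependent_of_isRationalClass hvrat fun q hq => ?_
    by_contra hq0
    have hl0 : (![0, q 0, q 1] : Fin 3 → ℚ) ≠ 0 := by
      intro h
      apply hq0
      funext j
      fin_cases j
      · exact congr_fun h 1
      · exact congr_fun h 2
    obtain ⟨k', hk'⟩ := hnd _ hl0
    apply hk'
    rw [← hv_eq q, hq, LinearMap.map_zero₂]
  have hnd2 : ∀ l : Fin 2 → ℚ, l ≠ 0 →
      ∃ k', cupProduct (show 2 * 4 + 2 * 4 = 16 by norm_num) (∑ j, ((l j : ℚ) : ℂ) • v j) (v k') ≠ 0 :=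
    weilPair_cupProduct_nondegenerate (n := 4) (by norm_num) hA Nat.one_pos hφ' _ hvW hli
  obtain ⟨c, hc⟩ := hshadow 2 v hvrat hvalg hnd2
  exact tropicalHodgeBound_pair Q hQ hQJ hgen c (fun j => h1 Q hQ hQJ hgen (c j)) hc

/-- **K2 ∧ HC(abelian, dim ≥ 8) ⟹ ¬K1** — the route's assembly contraposed and LOCALISED: through K2 as
typed, the Hodge conjecture enters only at K2's abelian eightfolds, so the registered residual
`SevenfoldWeilCensus.HodgeAbelianDimGeEight` (stmt-HodgeConjecture-18722: HC for complex abelian varieties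
of dimension `≥ 8`) already kills K1 granted K2; K3 is consumed in the pair form (two of the three shadow
cycles suffice). Equivalently K1 ∧ K2 ⟹ ¬HC(abelian, dim ≥ 8). [cite: Zharkov2020TropicalWeil, pp. 2–4] -/
theorem not_tropicalWeilVanishing_of_mumfordWeilShadow_of_hodgeAbelianDimGeEight
    (h2 : MumfordWeilShadow) (hHC : Theses.SevenfoldWeilCensus.HodgeAbelianDimGeEight) :
    ¬ TropicalWeilVanishing := by
  intro h1
  obtain ⟨Q, hQ, hQJ, hgen⟩ := tropicalWeilObstruction_genericWeilPeriod_proof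
  obtain ⟨A, φ, u, hdim, -, hu, -, -, hnd, hshadow⟩ := h2 Q hQ hQJ hgen
  have hHCA : HodgeConjectureFor 8 A.X := by
    have h := hHC A (hdim ▸ le_rfl) Motives.AbelianVariety.isSmoothProjective_holds
    rwa [hdim] at h
  have halg : ∀ k, u k ∈ algebraicClasses A.X 4 := fun k ↦ hHCA.2 4 (u k) (hu k).1 (hu k).2
  obtain ⟨c, hc⟩ := hshadow 3 u (fun k ↦ (hu k).1) halg hnd
  -- three independent classes contain an independent pair
  have hc2 : LinearIndependent ℚ fun j : Fin 2 => (c (Fin.castLE (by norm_num) j)).cyc :=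
    hc.comp _ (Fin.castLE_injective _)
  exact tropicalHodgeBound_pair Q hQ hQJ hgen (fun j => c (Fin.castLE (by norm_num) j))
    (fun j => h1 Q hQ hQJ hgen _) hc2

end Summit.HodgeConjecture.HodgeConjecture.Theorems.TropicalWeilVanishing

end
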